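import Summits.PneNP.PneNP.Theses.PositionalGames
import Summits.PneNP.PneNP.Theorems.PositionalGamesMpgTargetOfCruxes

/-!
# Route PositionalGames — assembly item `Assembly` (stmt-PneNP-1293)

`Summit.PneNP.PneNP.Theses.PositionalGames.Assembly :
  MpgMonotoneSuperpoly → MpgNoMonotoneGap → MpgHardNpLanguage → PneNP`.

Proof. (1) The landed glue `mpgTargetOfCruxes_proof` (item stmt-PneNP-1302, tree file
`PositionalGamesMpgTargetOfCruxes.lean`) turns the monotone lower bound M2 and the no-gap transfer
T-cap into Thesis X (`MpgGeneralSuperpoly`). (2) X + the NP language ⇒ `PneNP`, by contradiction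
exactly as in the route's deciding theorem `closes`: if `PneNP` failed, the language `L ∈ NP` of
`MpgHardNpLanguage` would lie in Cook's `P Bool`, hence — via the PROVED bridges `np_bool_eq`,
`P_bool_eq_holds`, `P_subset_PPoly_holds` (Arora–Barak Thm 6.6) — in `P/poly`, giving `B₂`
circuits of size `≤ n ^ c` for every mean-payoff template eventually, against X at exponent `c`
frequently (`Frequently.and_eventually`).

No literature fact is assumed: the three bridges are proved tree theorems (standard axioms).
-/

set_option linter.dupNamespace false -- `Summit.PneNP.PneNP.…`: summit = sub-problem name (D-0017 single-conjunct layout)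

namespace Summit.PneNP.PneNP.Theorems

open Filter
open Summit.PneNP.PneNP.Theses.PositionalGames (MpgMonotoneSuperpoly MpgNoMonotoneGap
  MpgGeneralSuperpoly MpgHardNpLanguage MpgTargetOfCruxes Assembly)

/-- **Assembly of route PositionalGames** (item stmt-PneNP-1293):
`MpgMonotoneSuperpoly → MpgNoMonotoneGap → MpgHardNpLanguage → PneNP`. Step (1): the glue
`mpgTargetOfCruxes_proof` gives Thesis X from M2 + T-cap. Step (2): if `PneNP` failed, the NP
language of `MpgHardNpLanguage` would be in Cook's `P Bool`, hence in `Classes.P`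
(`P_bool_eq_holds`) and in `P/poly` (`P_subset_PPoly_holds`), so every mean-payoff template would
have `B₂` circuits of size `≤ n ^ c` eventually — contradicting X at exponent `c`.
[AroraBarak2009 Thm 6.6] -/
theorem positionalGames_assembly_proof :
    Summit.PneNP.PneNP.Theses.PositionalGames.Assembly := by
  classical
  unfold Summit.PneNP.PneNP.Theses.PositionalGames.Assembly
  intro hM hT hL
  -- (1) M2 + T-cap ⇒ X, by the landed glue of item stmt-PneNP-1302
  have hX : MpgGeneralSuperpoly := by
    have h := mpgTargetOfCruxes_proof
    unfold Summit.PneNP.PneNP.Theses.PositionalGames.MpgTargetOfCruxes at h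
    exact h hM hT
  -- (2) X + the NP language ⇒ PneNP, by contradiction
  unfold Summit.PneNP.PneNP.Theses.PositionalGames.MpgGeneralSuperpoly at hX
  unfold Summit.PneNP.PneNP.Theses.PositionalGames.MpgHardNpLanguage at hL
  by_contra hne
  obtain ⟨L, hLNP, hLimp⟩ := hL
  -- model bridge NP (Cook) = NP (certificates): proved fact
  have hNP' : L ∈ Literature.Computability.Complexity.PNPWave0.NP Bool := by
    rw [Literature.Computability.Complexity.np_bool_eq]; exact hLNP
  -- if PneNP failed, L would be in Cook's P
  have hP : L ∈ Literature.Computability.Complexity.PNPWave0.P Bool := by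
    by_contra hnotP
    apply hne
    unfold PneNP Literature.PNP.PNeNP
    exact ⟨L, hNP', hnotP⟩
  -- model bridge P Bool = Classes.P (proved) and P ⊆ P/poly (proved)
  have hP2 : L ∈ Literature.Computability.Complexity.Classes.P := by
    have e := Literature.Computability.Complexity.P_bool_eq_holds
    unfold Literature.Computability.Complexity.P_bool_eq at e
    rw [← e]; exact hP
  have hPPoly : L ∈ Literature.Computability.Complexity.PPoly :=
    Literature.Computability.Complexity.P_subset_PPoly_holds hP2
  -- polynomial circuits for every mean-payoff template, eventually
  obtain ⟨c, hc⟩ := hLimp hPPoly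
  -- versus X at exponent c: frequently some template needs more than n ^ c gates
  obtain ⟨n, ⟨o, v, hlt⟩, hle⟩ := ((hX c).and_eventually hc).exists
  exact absurd (hle o v) (not_le.mpr hlt)

end Summit.PneNP.PneNP.Theorems
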